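import Literature.Topology.PlanarFoliations.HugFrame
import Literature.Topology.PlanarFoliations.LimitSets
import HarnessLib

/-!
# The hugging frame of an accumulating open leaf

Topic: Topology / PlanarFoliations, sequel to `HugFrame.lean` (hugging frames),
`LimitSets.lean` (the closure of a leaf is the leaf with its limit sets; a regular limit leaf is
compact or a separatrix), `OmegaLimit.lean`/`Reverse.lean` (no self-accumulation). An open leaf
`L = F.leaf y₀` lying in a compact set `C ⊆ Ω` hugs its **limit graph**

  `limGraph = (ω(L) ∪ α(L)) ∩ ι '' {y | F.leaf y not compact}`,

the points of its limit sets lying on line leaves: `StarData.spiralFrame` is the hugging frame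
with hugged set `limGraph`, hugger leaves all equal to `L`, and ambient compact set `C`:

* `sat`, `memC`, `sep` from the saturation of the limit sets and the trichotomy of
  `isCompact_or_of_mem_omegaSet`;
* `cross`: a prong point `x₀` of the limit graph is in the closure of `ι '' L` and off `ι '' L`
  (no self-accumulation), so `L` has points of the star sector near `x₀`; their heights are not
  `0` (height `0` is the prong, on the leaf through `x₀`, a limit leaf), hence `L` contains star
  horizontals of one sign at heights accumulating to `0`;
* `swept`: if `L` contains the horizontals of a prong `j` at nonzero heights `hₖ → 0`, the prong
  points are limits of points of `L` and are not on `L` — else `L` would be the prong leaf and the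
  points `horiz j hₖ b` of `L`, which stay off every compact leaf interval (an accumulation point in
  the leaf topology would be a point of `L` over `pt j (b, h*)` whose plaque neighbourhood contains
  at most one of them), would make `pt j (b, 0)` an ω- or α-limit point of `L` on `L`
  (`mem_omegaSet_or_alphaSet_of_escape`); and the prong leaf is not compact (it accumulates at the
  puncture).

## References

* C. Camacho, A. Lins Neto, *Geometric Theory of Foliations*, Birkhäuser (1985), Ch. VII §2
  [CamachoLinsNeto1985].
-/

noncomputable section

open Set Filter Function Metric
open _root_.Topology
open Literature.Topology.FourManifolds Literature.Topology.FourManifolds.Foliation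

namespace Literature.Topology.PlanarFoliations

variable {X : Type*} [TopologicalSpace X] [T2Space X] [SecondCountableTopology X] [Nonempty X] {F : Foliation ℝ X} {ι : X → ℂ}
variable {hbi : IsBiOriented F}

/-! ## Escaping sequences of leaf points accumulate in the limit sets -/

section Escape

variable {x : X} [NoncompactSpace (F.Leaf x)]

omit [Nonempty X] in
/-- **A sequence of points of an open leaf that eventually leaves every compact leaf interval,
and whose images converge, converges to an ω- or α-limit point.** [folklore] -/
theorem mem_omegaSet_or_alphaSet_of_escape (hbi : IsBiOriented F) {qs : ℕ → F.Leaf x} {z : ℂ}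
    (hz : Tendsto (fun k ↦ ι (Leaf.pt (qs k))) atTop (𝓝 z))
    (hesc : ∀ a c : F.Leaf x, ∀ᶠ k in atTop, qs k ∉ leafIcc hbi a c) :
    z ∈ omegaSet hbi ι x ∨ z ∈ alphaSet hbi ι x := by
  by_cases hfwd : ∀ p : F.Leaf x, ∃ᶠ k in atTop, qs k ∈ fwd hbi p
  · left
    rw [mem_omegaSet_iff]
    intro p
    exact mem_closure_iff_frequently.2 ((hz.frequently ((hfwd p).mono fun k hk ↦ ⟨qs k, hk, rfl⟩)).mono fun _ h ↦ h)
  · right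
    push Not at hfwd
    obtain ⟨p₀, hp₀⟩ := hfwd
    rw [mem_alphaSet_iff]
    intro p
    by_contra hnot
    have hbwd : ¬ ∃ᶠ k in atTop, qs k ∈ bwd hbi p := fun hfr ↦
      hnot (mem_closure_iff_frequently.2 ((hz.frequently (hfr.mono fun k hk ↦ ⟨qs k, hk, rfl⟩)).mono fun _ h ↦ h))
    have h1 : ∀ᶠ k in atTop, qs k ∉ fwd hbi p₀ := hp₀
    have h2 : ∀ᶠ k in atTop, qs k ∉ bwd hbi p := not_frequently.1 hbwd
    obtain ⟨k, ⟨hk1, hk2⟩, hk3⟩ := ((h1.and h2).and (hesc p p₀)).exists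
    simp only [fwd, bwd, mem_setOf_eq, not_not] at hk1 hk2
    exact hk3 ⟨leafLT_asymm hk2, leafLT_asymm hk1⟩

end Escape

/-! ## The limit graph of an open leaf -/

/-- **The limit graph** of the open leaf of `y₀`: the points of its ω- and α-limit sets lying on
non-compact leaves. [folklore] -/
def limGraph (hbi : IsBiOriented F) (ι : X → ℂ) (y₀ : X) [NoncompactSpace (F.Leaf y₀)] : Set ℂ :=
  {z | z ∈ omegaSet hbi ι y₀ ∪ alphaSet hbi ι y₀ ∧ ∃ y, ι y = z ∧ ¬ IsCompact (F.leaf y)}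

variable {y₀ : X} [NoncompactSpace (F.Leaf y₀)]

omit [Nonempty X] in
/-- The limit graph lies in the limit sets. [folklore] -/
theorem limGraph_subset : limGraph hbi ι y₀ ⊆ omegaSet hbi ι y₀ ∪ alphaSet hbi ι y₀ := fun _ h ↦ h.1

omit [Nonempty X] in
/-- No point of the leaf has its image in the limit sets. [folklore] -/
theorem not_mem_limitSets_of_mem_leaf (hbi : IsBiOriented F) (hι : IsOpenEmbedding ι) {x : X} (hx : x ∈ F.leaf y₀) :
    ι x ∉ omegaSet hbi ι y₀ ∪ alphaSet hbi ι y₀ := fun h ↦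
  h.elim (not_mem_omegaSet_self hbi hι (Leaf.mk x hx)) (not_mem_alphaSet_self hbi hι (Leaf.mk x hx))

omit [Nonempty X] in
/-- The limit sets are saturated. [folklore] -/
theorem mem_limitSets_of_mem_leaf (hι : IsOpenEmbedding ι) {y y' : X} (hy : ι y ∈ omegaSet hbi ι y₀ ∪ alphaSet hbi ι y₀)
    (hy' : y' ∈ F.leaf y) : ι y' ∈ omegaSet hbi ι y₀ ∪ alphaSet hbi ι y₀ :=
  hy.imp (fun h ↦ mem_omegaSet_of_mem_leaf hι h hy') (fun h ↦ mem_alphaSet_of_mem_leaf hι h hy')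

omit [Nonempty X] in
/-- The limit sets lie in the closure of the image of the leaf. [folklore] -/
theorem limitSets_subset_closure (hι : IsOpenEmbedding ι) :
    omegaSet hbi ι y₀ ∪ alphaSet hbi ι y₀ ⊆ closure (ι '' F.leaf y₀) := by
  rw [closure_image_leaf hι, union_assoc]
  exact subset_union_right

namespace StarData

variable {B : Type*} [NormedAddCommGroup B] {M : Type*} [TopologicalSpace M] {T : Foliation B M} {g : ℂ → M}
variable (D : StarData F ι T g) (hbi) (hι : IsOpenEmbedding ι) {C : Set ℂ} (hC : IsCompact C) (hCΩ : C ⊆ D.Ω)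
  (hmem : ∀ q : F.Leaf y₀, ι (Leaf.pt q) ∈ C)

/-! ## Crossings near a prong point of the limit graph -/

/-- **An open leaf crosses the star vertical at a prong point of its limit graph**, on one side,
at heights accumulating to `0`. [folklore] -/
theorem exists_sign_horiz_mem_leaf {v : ℂ} (hv : D.nprong v ≠ 0) {j : ZMod (D.nprong v)} {β r : ℝ}
    (hβ : β ∈ Ioo 0 (D.star v hv).ρ) (hr : 0 < r) (hball : ball ((D.star v hv).pt j (β, 0)) r ⊆ (D.star v hv).S j \ {v})
    (hx₀ : (D.star v hv).pt j (β, 0) ∈ limGraph hbi ι y₀) :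
    ∃ s : ℝ, (s = 1 ∨ s = -1) ∧ ∀ ε > 0, ∃ h, 0 < s * h ∧ |h| < ε ∧ (D.star v hv).horiz hι j h β ∈ F.leaf y₀ := by
  set P := D.star v hv with hP
  obtain ⟨hωα, y, hyx₀, -⟩ := hx₀
  have hrβ : ((β, (0 : ℝ)) : ℝ × ℝ) ∈ P.rect := (P.mem_rect_iff).2 ⟨⟨hβ.1.le, hβ.2.le⟩, by simp [P.ρ_pos.le]⟩
  have hneβ : ((β, (0 : ℝ)) : ℝ × ℝ) ≠ 0 := fun h ↦ hβ.1.ne' (congrArg Prod.fst h)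
  have hyeq : y = P.horiz hι j 0 β := hι.injective (by rw [hyx₀, P.ι_horiz hι hrβ hneβ])
  -- crossings of some sign below every `ε`
  have key : ∀ ε > 0, ∃ h, h ≠ 0 ∧ |h| < ε ∧ P.horiz hι j h β ∈ F.leaf y₀ := by
    intro ε hε
    have hSj : P.S j ∈ 𝓝 (P.pt j (β, 0)) := Filter.mem_of_superset (ball_mem_nhds _ hr) (hball.trans fun _ h ↦ h.1)
    have hx₀S : P.pt j (β, 0) ∈ P.S j := P.pt_mem hrβ
    have hcH : ContinuousAt P.H (P.pt j (β, 0)) := ((P.continuousOn_H j) _ hx₀S).continuousAt hSj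
    have hcb : ContinuousAt (P.b j) (P.pt j (β, 0)) := ((P.continuousOn_b j) _ hx₀S).continuousAt hSj
    have h1 : ∀ᶠ z in 𝓝 (P.pt j (β, 0)), |P.H z| < ε := by
      have := hcH.preimage_mem_nhds (Ioo_mem_nhds (show -ε < P.H (P.pt j (β, 0)) by rw [P.H_pt hrβ]; linarith)
        (show P.H (P.pt j (β, 0)) < ε by rw [P.H_pt hrβ]; exact hε))
      exact Filter.Eventually.mono this fun z hz ↦ abs_lt.2 hz
    have h2 : ∀ᶠ z in 𝓝 (P.pt j (β, 0)), 0 < P.b j z := by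
      have := hcb.preimage_mem_nhds (Ioi_mem_nhds (show 0 < P.b j (P.pt j (β, 0)) by rw [P.b_pt hrβ]; exact hβ.1))
      exact Filter.Eventually.mono this fun z hz ↦ hz
    have h3 : ∀ᶠ z in 𝓝 (P.pt j (β, 0)), z ∈ ball (P.pt j (β, 0)) r := ball_mem_nhds _ hr
    have hfr : ∃ᶠ z in 𝓝 (P.pt j (β, 0)), z ∈ ι '' F.leaf y₀ :=
      mem_closure_iff_frequently.1 (limitSets_subset_closure hι hωα)
    obtain ⟨z, ⟨x, hxL, rfl⟩, ⟨hzH, hzb⟩, hzr⟩ := (hfr.and_eventually ((h1.and h2).and h3)).exists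
    have hxS : ι x ∈ P.S j := (hball hzr).1
    have hrect := P.chart_mem_rect hxS
    rw [P.chart_apply, P.mem_rect_iff] at hrect
    have hxeq : x = P.horiz hι j (P.H (ι x)) (P.b j (ι x)) := (P.horiz_b_eq hι hxS).symm
    by_cases hh : P.H (ι x) = 0
    · -- height `0`: a prong point, on the limit leaf through `x₀`
      exfalso
      have hrb : ((P.b j (ι x), (0 : ℝ)) : ℝ × ℝ) ∈ P.rect := (P.mem_rect_iff).2 ⟨hrect.1, by simp [P.ρ_pos.le]⟩
      have hxy : x ∈ F.leaf y := by
        rw [hyeq, hxeq, hh]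
        exact P.horiz_mem_leaf' hι hrβ hrb (Or.inr ⟨hβ.1, hzb⟩)
      exact not_mem_limitSets_of_mem_leaf hbi hι hxL (mem_limitSets_of_mem_leaf hι (by rw [hyx₀]; exact hωα) hxy)
    · refine ⟨P.H (ι x), hh, hzH, ?_⟩
      have hrh : ((P.b j (ι x), P.H (ι x)) : ℝ × ℝ) ∈ P.rect := (P.mem_rect_iff).2 ⟨hrect.1, hrect.2⟩
      have hrh' : ((β, P.H (ι x)) : ℝ × ℝ) ∈ P.rect := (P.mem_rect_iff).2 ⟨⟨hβ.1.le, hβ.2.le⟩, hrect.2⟩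
      have h := P.horiz_mem_leaf' hι (j := j) hrh hrh' (Or.inl hh)
      rw [← hxeq, leaf_eq_of_mem hxL] at h
      exact h
  -- one sign serves all `ε`
  by_cases hpos : ∀ ε > 0, ∃ h, 0 < h ∧ |h| < ε ∧ P.horiz hι j h β ∈ F.leaf y₀
  · exact ⟨1, Or.inl rfl, fun ε hε ↦ by simpa only [one_mul] using hpos ε hε⟩
  by_cases hneg : ∀ ε > 0, ∃ h, h < 0 ∧ |h| < ε ∧ P.horiz hι j h β ∈ F.leaf y₀
  · refine ⟨-1, Or.inr rfl, fun ε hε ↦ ?_⟩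
    obtain ⟨h, hh, hhε, hm⟩ := hneg ε hε
    exact ⟨h, by linarith, hhε, hm⟩
  exfalso
  push Not at hpos hneg
  obtain ⟨ε₁, hε₁, h₁⟩ := hpos
  obtain ⟨ε₂, hε₂, h₂⟩ := hneg
  obtain ⟨h, hh0, hhε, hm⟩ := key (min ε₁ ε₂) (lt_min hε₁ hε₂)
  rcases lt_or_gt_of_ne hh0 with hlt | hlt
  · exact absurd hm (h₂ h hlt (hhε.trans_le (min_le_right _ _)))
  · exact absurd hm (h₁ h hlt (hhε.trans_le (min_le_left _ _)))

/-! ## Prongs swept by the leaf -/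

omit [T2Space X] [SecondCountableTopology X] in
/-- **The prong leaf of a star is not compact**: it accumulates at the puncture. [folklore] -/
theorem not_isCompact_leaf_horiz_zero {v : ℂ} (hv : D.nprong v ≠ 0) (j : ZMod (D.nprong v)) {b : ℝ} (hb : b ∈ Ioc 0 (D.star v hv).ρ) :
    ¬ IsCompact (F.leaf ((D.star v hv).horiz hι j 0 b)) := by
  set P := D.star v hv with hP
  intro hK
  have hr : ∀ {b' : ℝ}, b' ∈ Ioc 0 P.ρ → ((b', (0 : ℝ)) : ℝ × ℝ) ∈ P.rect := fun {b'} hb' ↦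
    (P.mem_rect_iff).2 ⟨⟨hb'.1.le, hb'.2⟩, by simp [P.ρ_pos.le]⟩
  have hne : ∀ {b' : ℝ}, b' ∈ Ioc 0 P.ρ → ((b', (0 : ℝ)) : ℝ × ℝ) ≠ 0 := fun {b'} hb' h ↦ hb'.1.ne' (congrArg Prod.fst h)
  have hcl : IsClosed (ι '' F.leaf (P.horiz hι j 0 b)) := (hK.image hι.continuous).isClosed
  -- the prong points are images of points of the leaf, and tend to `v`
  have hmemv : v ∈ closure (ι '' F.leaf (P.horiz hι j 0 b)) := by
    rw [Metric.mem_closure_iff]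
    intro ε hε
    have hc := (P.continuousOn_pt j) 0 P.zero_mem_rect
    obtain ⟨δ, hδ, hclose⟩ := (Metric.continuousWithinAt_iff.1 hc) ε hε
    set b' := min b (δ / 2) with hb'
    have hb'I : b' ∈ Ioc 0 P.ρ := ⟨lt_min hb.1 (by linarith), (min_le_left _ _).trans hb.2⟩
    refine ⟨P.pt j (b', 0), ⟨P.horiz hι j 0 b', P.prong_mem_leaf hι hb hb'I (P.ι_horiz hι (hr hb) (hne hb))
      (P.ι_horiz hι (hr hb'I) (hne hb'I)), P.ι_horiz hι (hr hb'I) (hne hb'I)⟩, ?_⟩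
    have h := hclose (hr hb'I) (by
      rw [dist_zero_right, Prod.norm_mk, Real.norm_eq_abs, Real.norm_eq_abs, abs_zero, abs_of_pos hb'I.1]
      exact max_lt (by linarith [min_le_right b (δ / 2)]) hδ)
    rw [P.pt_zero] at h
    rw [dist_comm]; exact h
  rw [hcl.closure_eq] at hmemv
  obtain ⟨x, -, hx⟩ := hmemv
  exact P.not_mem_range ⟨x, hx⟩

/-- **Prongs swept by the horizontals of an open leaf at heights accumulating to `0` are in its
limit graph.** [folklore] -/
theorem pt_mem_limGraph_of_horiz {v : ℂ} (hv : D.nprong v ≠ 0) {j : ZMod (D.nprong v)}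
    (hpass : ∀ δ > (0 : ℝ), ∃ h : ℝ, h ≠ 0 ∧ |h| < δ ∧ ∀ b ∈ Icc 0 (D.star v hv).ρ, (D.star v hv).horiz hι j h b ∈ F.leaf y₀)
    {b : ℝ} (hb : b ∈ Ioc 0 (D.star v hv).ρ) : (D.star v hv).pt j (b, 0) ∈ limGraph hbi ι y₀ := by
  set P := D.star v hv with hP
  -- the heights
  have hseq : ∀ k : ℕ, ∃ h : ℝ, h ≠ 0 ∧ |h| < min P.ρ (1 / ((k : ℝ) + 1)) ∧ ∀ b' ∈ Icc 0 P.ρ, P.horiz hι j h b' ∈ F.leaf y₀ :=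
    fun k ↦ hpass _ (lt_min P.ρ_pos (by positivity))
  choose hs hs0 hslt hsmem using hseq
  have hsρ : ∀ k, |hs k| < P.ρ := fun k ↦ (hslt k).trans_le (min_le_left _ _)
  have hs_tend : Tendsto hs atTop (𝓝 0) := by
    rw [tendsto_zero_iff_abs_tendsto_zero]
    refine squeeze_zero (fun k ↦ abs_nonneg _) (fun k ↦ ((hslt k).trans_le (min_le_right _ _)).le) ?_
    exact tendsto_one_div_add_atTop_nhds_zero_nat
  have hbI : b ∈ Icc 0 P.ρ := ⟨hb.1.le, hb.2⟩
  have hrect : ∀ h : ℝ, |h| < P.ρ → ((b, h) : ℝ × ℝ) ∈ P.rect := fun h hh ↦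
    (P.mem_rect_iff).2 ⟨hbI, ⟨(abs_lt.1 hh).1.le, (abs_lt.1 hh).2.le⟩⟩
  have hne : ∀ h : ℝ, ((b, h) : ℝ × ℝ) ≠ 0 := fun h h0 ↦ hb.1.ne' (congrArg Prod.fst h0)
  have hrect0 : ((b, (0 : ℝ)) : ℝ × ℝ) ∈ P.rect := hrect 0 (by rw [abs_zero]; exact P.ρ_pos)
  -- the points `x k` of `L` over `pt j (b, hs k)`
  set x : ℕ → X := fun k ↦ P.horiz hι j (hs k) b with hxdef
  have hxL : ∀ k, x k ∈ F.leaf y₀ := fun k ↦ hsmem k b hbI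
  have hιx : ∀ k, ι (x k) = P.pt j (b, hs k) := fun k ↦ P.ι_horiz hι (hrect _ (hsρ k)) (hne _)
  have hHx : ∀ k, P.H (ι (x k)) = hs k := fun k ↦ by rw [hιx, P.H_pt (hrect _ (hsρ k))]
  have hxS : ∀ k, ι (x k) ∈ P.S j := fun k ↦ by rw [hιx]; exact P.pt_mem (hrect _ (hsρ k))
  -- their images converge to the prong point
  have htend : Tendsto (fun k ↦ ι (x k)) atTop (𝓝 (P.pt j (b, 0))) := by
    simp_rw [hιx]
    have hc : ContinuousWithinAt (P.pt j) P.rect (b, 0) := (P.continuousOn_pt j) _ hrect0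
    refine hc.tendsto.comp (tendsto_nhdsWithin_iff.2 ⟨?_, Eventually.of_forall fun k ↦ hrect _ (hsρ k)⟩)
    exact (tendsto_const_nhds.prodMk_nhds hs_tend)
  have hcl : P.pt j (b, 0) ∈ closure (ι '' F.leaf y₀) :=
    mem_closure_of_tendsto htend (Eventually.of_forall fun k ↦ ⟨x k, hxL k, rfl⟩)
  -- the prong point is not on the leaf
  have hnot : P.pt j (b, 0) ∉ ι '' F.leaf y₀ := by
    rintro ⟨w, hwL, hw⟩
    -- the leaf points `q k` over the `x k`
    set q : ℕ → F.Leaf y₀ := fun k ↦ Leaf.mk (x k) (hxL k) with hqdef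
    have hq : ∀ k, Leaf.pt (q k) = x k := fun k ↦ rfl
    -- they leave every compact leaf interval
    have hesc : ∀ a c : F.Leaf y₀, ∀ᶠ k in atTop, q k ∉ leafIcc hbi a c := by
      intro a c
      rw [← Nat.cofinite_eq_atTop, Filter.eventually_cofinite]
      by_contra hinf
      rw [Set.not_finite] at hinf
      -- the set of indices landing in the interval is infinite; so is the set of their points
      set S := {k | q k ∈ leafIcc hbi a c} with hS
      have hSinf : S.Infinite := by simpa only [hS, not_not, setOf_mem_eq] using hinf
      have hTinf : (q '' S).Infinite := by
        intro hTfin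
        have hHfin : ((fun q' : F.Leaf y₀ ↦ P.H (ι (Leaf.pt q'))) '' (q '' S)).Finite := hTfin.image _
        -- a positive lower bound for the heights of finitely many points, all nonzero
        obtain ⟨δ, hδ, hδle⟩ : ∃ δ > (0 : ℝ), ∀ t ∈ (fun q' : F.Leaf y₀ ↦ P.H (ι (Leaf.pt q'))) '' (q '' S), δ ≤ |t| := by
          rcases ((fun q' : F.Leaf y₀ ↦ P.H (ι (Leaf.pt q'))) '' (q '' S)).eq_empty_or_nonempty with h | h
          · exact ⟨1, one_pos, by rw [h]; simp⟩
          · obtain ⟨t₀, ht₀, hmin⟩ := hHfin.exists_minimalFor (fun t ↦ |t|) _ h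
            have ht₀ne : t₀ ≠ 0 := by
              obtain ⟨_, ⟨k, -, rfl⟩, rfl⟩ := ht₀
              show P.H (ι (Leaf.pt (q k))) ≠ 0
              rw [hq, hHx]; exact hs0 k
            refine ⟨|t₀|, abs_pos.2 ht₀ne, fun t ht ↦ ?_⟩
            by_contra hlt
            push Not at hlt
            exact absurd (hmin ht hlt.le) (not_le.2 hlt)
        obtain ⟨K₀, hK₀⟩ := (Metric.tendsto_atTop.1 hs_tend) δ hδ
        obtain ⟨k, hkS, hkK⟩ := hSinf.exists_gt K₀
        have h1 := hδle _ ⟨q k, ⟨k, hkS, rfl⟩, rfl⟩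
        simp only [hq, hHx] at h1
        have h2 := hK₀ k hkK.le
        rw [dist_zero_right, Real.norm_eq_abs] at h2
        linarith
      -- an accumulation point in the compact leaf interval
      obtain ⟨q₀, -, hacc⟩ := hTinf.exists_accPt_of_subset_isCompact (isCompact_leafIcc a c)
        (by rintro _ ⟨k, hk, rfl⟩; exact hk)
      rw [accPt_iff_nhds] at hacc
      have hcpt : Continuous (Leaf.pt : F.Leaf y₀ → X) := Leaf.continuous_coe F y₀
      -- its image is on the star vertical over `b`
      set Vseg : Set ℂ := (fun h : ℝ ↦ P.pt j (b, h)) '' Icc (-P.ρ) P.ρ with hVseg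
      have hVc : IsCompact Vseg := isCompact_Icc.image_of_continuousOn
        ((P.continuousOn_pt j).comp (continuous_const.prodMk continuous_id).continuousOn fun h hh ↦
          (P.mem_rect_iff).2 ⟨hbI, hh⟩)
      have hq₀V : ι (Leaf.pt q₀) ∈ Vseg := by
        refine hVc.isClosed.closure_subset ?_
        rw [Metric.mem_closure_iff]
        intro ε hε
        have hO : (fun q' : F.Leaf y₀ ↦ ι (Leaf.pt q')) ⁻¹' ball (ι (Leaf.pt q₀)) ε ∈ 𝓝 q₀ :=
          (hι.continuous.comp hcpt).continuousAt.preimage_mem_nhds (ball_mem_nhds _ hε)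
        obtain ⟨q', ⟨hq'O, k, -, rfl⟩, -⟩ := hacc _ hO
        refine ⟨ι (x k), ⟨hs k, ⟨(abs_lt.1 (hsρ k)).1.le, (abs_lt.1 (hsρ k)).2.le⟩, (hιx k).symm⟩, ?_⟩
        rw [dist_comm]; exact hq'O
      obtain ⟨h₀, hh₀, hq₀eq⟩ := hq₀V
      have hrh₀ : ((b, h₀) : ℝ × ℝ) ∈ P.rect := (P.mem_rect_iff).2 ⟨hbI, hh₀⟩
      have hq₀S : ι (Leaf.pt q₀) ∈ P.S j := by rw [← hq₀eq]; exact P.pt_mem hrh₀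
      have hHq₀ : P.H (ι (Leaf.pt q₀)) = h₀ := by rw [← hq₀eq, P.H_pt hrh₀]
      -- a flow box at it with heights increasing in `H`
      obtain ⟨e, he, hq₀e, U, hU, hmono⟩ := P.foliated j (Leaf.pt q₀) hq₀S
      obtain ⟨U', hU'U, hU'o, hq₀U'⟩ := mem_nhds_iff.1 hU
      -- the plaque neighbourhood of `q₀` in the leaf
      set N : Set (F.Leaf y₀) := {q' | Leaf.pt q' ∈ U' ∧ Leaf.pt q' ∈ plaque e (e (Leaf.pt q₀)).2} with hN
      have hNo : IsOpen N := (hU'o.preimage hcpt).inter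
        ((F.isOpen_preimage_plaque_leafSpace he _).preimage continuous_subtype_val)
      have hq₀N : q₀ ∈ N := ⟨hq₀U', mem_plaque_self hq₀e⟩
      -- all points of the sequence in it have height `h₀`, so are one point
      have hone : ∀ k, q k ∈ N → x k = P.horiz hι j h₀ b := by
        intro k hk
        have hk1 : Leaf.pt (q k) ∈ U := hU'U hk.1
        have heq : (e (x k)).2 = (e (Leaf.pt q₀)).2 := hk.2.2
        have m1 := hmono (x k) hk1 (hxS k) (Leaf.pt q₀) (mem_of_mem_nhds hU) hq₀S
        have m2 := hmono (Leaf.pt q₀) (mem_of_mem_nhds hU) hq₀S (x k) hk1 (hxS k)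
        have hH : P.H (ι (x k)) = P.H (ι (Leaf.pt q₀)) := by
          rcases lt_trichotomy (P.H (ι (x k))) (P.H (ι (Leaf.pt q₀))) with h | h | h
          · exact absurd (m1.2 h) (by rw [heq]; exact lt_irrefl _)
          · exact h
          · exact absurd (m2.2 h) (by rw [heq]; exact lt_irrefl _)
        rw [hHx, hHq₀] at hH
        show P.horiz hι j (hs k) b = P.horiz hι j h₀ b
        rw [hH]
      -- remove that point and contradict accumulation
      by_cases hx₀ : ∃ k, q k ∈ N ∧ q k ≠ q₀
      · obtain ⟨k₁, hk₁N, hk₁ne⟩ := hx₀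
        have hO : N ∩ (Leaf.pt ⁻¹' {x k₁}ᶜ) ∈ 𝓝 q₀ := by
          refine (hNo.inter ((isClosed_singleton.preimage hcpt).isOpen_compl)).mem_nhds ⟨hq₀N, ?_⟩
          intro h
          exact hk₁ne (Leaf.injective_coe F y₀ (show Leaf.pt (q k₁) = Leaf.pt q₀ from (hq k₁).trans (mem_singleton_iff.1 h).symm))
        obtain ⟨q', ⟨⟨hq'N, hq'ne⟩, k, -, rfl⟩, -⟩ := hacc _ hO
        exact hq'ne (show Leaf.pt (q k) = x k₁ by rw [hq, hone k hq'N, ← hone k₁ hk₁N])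
      · push Not at hx₀
        obtain ⟨q', ⟨hq'N, k, -, rfl⟩, hq'ne⟩ := hacc _ (hNo.mem_nhds hq₀N)
        exact hq'ne (hx₀ k hq'N)
    -- so the prong point is an ω- or α-limit point on the leaf: impossible
    have hz : Tendsto (fun k ↦ ι (Leaf.pt (q k))) atTop (𝓝 (ι w)) := by rw [hw]; exact htend
    have hωα := mem_omegaSet_or_alphaSet_of_escape hbi hz hesc
    exact not_mem_limitSets_of_mem_leaf hbi hι hwL hωα
  -- conclusion
  have hωα : P.pt j (b, 0) ∈ omegaSet hbi ι y₀ ∪ alphaSet hbi ι y₀ := by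
    rw [closure_image_leaf (hbi := hbi) hι] at hcl
    rcases hcl with (h | h) | h
    · exact absurd h hnot
    · exact Or.inl h
    · exact Or.inr h
  exact ⟨hωα, P.horiz hι j 0 b, P.ι_horiz hι hrect0 (hne 0), D.not_isCompact_leaf_horiz_zero hι hv j hb⟩

/-! ## The frame -/

include hC hCΩ hmem in
/-- **The hugging frame of an accumulating open leaf**: hugged set its limit graph, hugger the
leaf itself, ambient compact set `C`. [folklore] -/
theorem spiralFrame : D.HugFrame hbi hι C (limGraph hbi ι y₀) (fun _ ↦ y₀) where
  hC := hC
  memC y hy y' hy' := by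
    have h := mem_limitSets_of_mem_leaf hι (limGraph_subset hy) hy'
    exact h.elim (fun h ↦ omegaSet_subset_of_forall_mem hC.isClosed hmem h)
      (fun h ↦ alphaSet_subset_of_forall_mem hC.isClosed hmem h)
  sat y hy y' hy' := by
    refine ⟨mem_limitSets_of_mem_leaf hι (limGraph_subset hy) hy', y', rfl, ?_⟩
    obtain ⟨-, y₁, hy₁, hnc⟩ := hy
    rw [hι.injective hy₁] at hnc
    rw [leaf_eq_of_mem hy']; exact hnc
  sep y hy := by
    obtain ⟨hωα, y₁, hy₁, hnc⟩ := hy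
    rw [hι.injective hy₁] at hnc
    rcases hωα with h | h
    · exact (D.toPunctureData.isCompact_or_of_mem_omegaSet hι hC hCΩ hmem h).resolve_left hnc
    · exact (D.toPunctureData.isCompact_or_of_mem_alphaSet hι hC hCΩ hmem h).resolve_left hnc
  cross hv _ _ _ hβ hr hball hx₀ := by
    obtain ⟨s, hs, h⟩ := D.exists_sign_horiz_mem_leaf hbi hι hv hβ hr hball hx₀
    exact ⟨s, hs, fun ε hε ↦ ⟨0, fun m _ ↦ h ε hε⟩⟩
  swept hv _ hpass b hb := D.pt_mem_limGraph_of_horiz hbi hι hv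
    (fun δ hδ ↦ by obtain ⟨m, -, h, hh0, hhδ, hhor⟩ := hpass 0 δ hδ; exact ⟨h, hh0, hhδ, hhor⟩) hb

end StarData

end Literature.Topology.PlanarFoliations
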